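import Literature.NumberTheory.BeurlingPrimes.BDRMultisetPrimes
import Literature.NumberTheory.BeurlingPrimes.PrescribedZerosMultiset
import Literature.NumberTheory.BeurlingPrimes.LogZetaMellin
import Mathlib.Analysis.MellinTransform
import HarnessLib

/-!
# BDR Theorem 3.2, the zeta side: `Z(s) = ℳ{dΠ_𝒫 − dG; s}` is holomorphic on `Re s > 0` and `ζ_𝒫 = E_M e^Z`

Topic `Literature/NumberTheory/BeurlingPrimes`, grouping namespace `BDRMultiset`. Everything in this file is PROVED.

Broucke–Debruyne–Révész (2023), proof of Theorem 3.2: "`log ζ_𝒫(s) = Σ log(1/(1 − p_j^{−s})) = ∫_1^∞ x^{−s} dΠ_𝒫(x)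
= ℳ{dΠ_𝒫; s}`. … `ℳ{dG; s} = log(s/(s−1)) + Σ_ω log(s/(s−ω)) + Σ_ρ log((s−ρ)/s) + M log(s/(s−δ))`. Moreover, the error
`Z(s) := ℳ{dΠ_𝒫 − dG; s}` here arises as the Mellin–Stieltjes transform of the error function `Π_𝒫(x) − G(x)`, which
is `O(log log x)`. Hence `Z(s)` is analytic for `Re s > 0`. Recalling the definition (3.4) of `E(s)`, we have
`E(s) = exp(ℳ{dG; s})`, so that `ζ_𝒫(s) = E(s)e^{Z(s)}`." Here, for a Beurling system `𝒫` and the template pair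
`(F, G)` of `BDRMultisetTemplate.lean` (with `Π_𝒫 − G = O(log x)` from `BDRMultisetPrimes.lean`):

* `Zfn … s = s ∫_1^∞ (Π_𝒫(x) − G(x)) x^{−s−1} dx` (the Mellin–Stieltjes transform after integration by parts) and
  `differentiableOn_Zfn` — **`Z` is holomorphic on `Re s > 0`** (a Mellin transform of a function `O(x^ε)` for
  every `ε > 0`; generic lemma `differentiableOn_mul_mellinIoi`);
* `mul_integral_riemannPrimeCount_eq_tsum_log` — `s ∫_1^∞ Π_𝒫 x^{−s−1} = Σ_j log((1 − λ_j^{−s})⁻¹)` (`σ > 0`,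
  `Σ λ_j^{−σ} < ∞`), and `mul_integral_tmplG_eq` — `s ∫_1^∞ G(x) x^{−s−1} dx = ∫_1^∞ g(u) u^{−s} du` (`σ > 1`);
* `ofReal_densG_eq` — for `u > 1`, `g(u) = cpowDensity 1 u + Σ_𝒮 cpowDensity ω u − Σ_ℛ cpowDensity ρ u +
  M cpowDensity δ u` (symmetric multisets), hence `exp_integral_densG` —
  **`exp ∫_1^∞ g(u) u^{−s} du = E_M(s)`** (`= bdrE ℛ 𝒮 δ M s`, tree `exp_integral_cpowDensity_mul_cpow`);
* `zeta_eq_bdrE_mul_exp_Zfn` — **`ζ_𝒫(s) = E_M(s) e^{Z(s)}` for `Re s > 1`**.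

## References
* [BrouckeDebruyneRevesz2023] F. Broucke, G. Debruyne, Sz. Gy. Révész, *Some examples of well-behaved Beurling
  number systems*, arXiv:2309.01567, proof of Theorem 3.2 (the displays for `log ζ_𝒫`, `ℳ{dG; s}`, `Z(s)`) (read).
-/

noncomputable section

open Filter Topology Complex Set MeasureTheory intervalIntegral Asymptotics
open scoped ComplexConjugate

namespace Literature.NumberTheory.BeurlingPrimes

open Literature.Barriers.RiemannHypothesis

/-! ### Generic: Mellin transforms over `(1,∞)` of functions `O(log x)` are holomorphic on `Re w > 0` -/

section MellinGeneric

variable {h : ℝ → ℂ} {C : ℝ}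

/-- The kernel function `1_{(1,∞)} h`. [folklore] -/
def indIoi (h : ℝ → ℂ) : ℝ → ℂ := (Ioi 1).indicator h

/-- `∫_1^∞ h(v) v^{−w−1} dv = mellin (1_{(1,∞)} h) (−w)`. [folklore] -/
theorem integral_mul_cpow_eq_mellin (h : ℝ → ℂ) (w : ℂ) :
    ∫ v in Ioi (1 : ℝ), h v * (v : ℂ) ^ (-w - 1) = mellin (indIoi h) (-w) := by
  rw [mellin]
  have hf : (fun v : ℝ ↦ (v : ℂ) ^ (-w - 1) • indIoi h v) =
      (Ioi 1).indicator fun v ↦ h v * (v : ℂ) ^ (-w - 1) := by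
    funext v
    simp only [indIoi, smul_eq_mul]
    by_cases hv : v ∈ Ioi (1 : ℝ)
    · rw [indicator_of_mem hv, indicator_of_mem hv, mul_comm]
    · rw [indicator_of_notMem hv, indicator_of_notMem hv, mul_zero]
  rw [hf, setIntegral_indicator measurableSet_Ioi]
  congr 1
  rw [Measure.restrict_congr_set (show (Ioi (0 : ℝ) ∩ Ioi 1 : Set ℝ) =ᵐ[volume] Ioi 1 by
    rw [Ioi_inter_Ioi, max_eq_right zero_le_one])]

/-- Local integrability of `1_{(1,∞)} h` on `(0,∞)` from a bound `‖h v‖ ≤ C(1 + log v)`. [folklore] -/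
theorem locallyIntegrableOn_indIoi (hm : AEStronglyMeasurable h (volume.restrict (Ioi 1)))
    (hb : ∀ v, 1 < v → ‖h v‖ ≤ C * (1 + Real.log v)) : LocallyIntegrableOn (indIoi h) (Ioi 0) := by
  have hC : 0 ≤ C := by
    have h2 := hb 2 one_lt_two
    have : 0 < 1 + Real.log 2 := by have := Real.log_pos one_lt_two; linarith
    nlinarith [norm_nonneg (h 2)]
  have hint : ∀ X : ℝ, IntegrableOn (indIoi h) (Ioc 0 X) := by
    intro X
    unfold indIoi
    rw [integrableOn_indicator_iff measurableSet_Ioi]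
    have hsub : Ioi 1 ∩ Ioc (0 : ℝ) X ⊆ Ioc 1 X := fun v hv ↦ ⟨hv.1, hv.2.2⟩
    refine IntegrableOn.mono_set ?_ hsub
    rcases le_or_gt X 1 with hX | hX
    · rw [Ioc_eq_empty (by simpa using hX)]; exact integrableOn_empty
    have hmeas : AEStronglyMeasurable h (volume.restrict (Ioc 1 X)) :=
      hm.mono_measure (Measure.restrict_mono Ioc_subset_Ioi_self le_rfl)
    refine Integrable.mono' (g := fun _ ↦ C * (1 + Real.log X)) (integrableOn_const (by simp)) hmeas ?_
    rw [ae_restrict_iff' measurableSet_Ioc]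
    refine Eventually.of_forall fun v hv ↦ (hb v hv.1).trans ?_
    exact mul_le_mul_of_nonneg_left (by linarith [Real.log_le_log (by linarith [hv.1]) hv.2]) hC
  rw [locallyIntegrableOn_iff isOpen_Ioi.isLocallyClosed]
  intro k hk hkc
  obtain ⟨X, hX⟩ := hkc.isBounded.bddAbove
  exact (hint X).mono_set fun v hv ↦ ⟨hk hv, hX hv⟩

/-- `1_{(1,∞)} h = O(v^ε)` at `∞` for every `ε > 0` (`log v ≤ v^ε/ε`). [folklore] -/
theorem indIoi_isBigO_top (hb : ∀ v, 1 < v → ‖h v‖ ≤ C * (1 + Real.log v)) {ε : ℝ} (hε : 0 < ε) :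
    indIoi h =O[atTop] fun v : ℝ ↦ v ^ (-(-ε)) := by
  have hC : 0 ≤ C := by
    have h2 := hb 2 one_lt_two
    have : 0 < 1 + Real.log 2 := by have := Real.log_pos one_lt_two; linarith
    nlinarith [norm_nonneg (h 2)]
  refine IsBigO.of_bound (C * (1 + 1 / ε)) ?_
  filter_upwards [eventually_gt_atTop (1 : ℝ)] with v hv
  have hv0 : 0 ≤ v := by linarith
  have hvε : 1 ≤ v ^ ε := Real.one_le_rpow hv.le hε.le
  rw [indIoi, indicator_of_mem (mem_Ioi.mpr hv), neg_neg, Real.norm_eq_abs, abs_of_nonneg (by positivity)]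
  refine (hb v hv).trans ?_
  have hlog := Real.log_le_rpow_div hv0 hε
  calc C * (1 + Real.log v) ≤ C * (v ^ ε + v ^ ε / ε) := mul_le_mul_of_nonneg_left (by linarith) hC
    _ = C * (1 + 1 / ε) * v ^ ε := by ring

/-- `1_{(1,∞)} h = 0` near `0⁺`. [folklore] -/
theorem indIoi_isBigO_zero (h : ℝ → ℂ) (b : ℝ) : indIoi h =O[𝓝[>] 0] fun v : ℝ ↦ v ^ (-b) := by
  have h1 : indIoi h =ᶠ[𝓝[>] 0] fun _ ↦ (0 : ℂ) := by
    have : Ioo (0 : ℝ) 1 ∈ 𝓝[>] (0 : ℝ) := Ioo_mem_nhdsGT one_pos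
    filter_upwards [this] with v hv
    rw [indIoi, indicator_of_notMem (by simpa using hv.2.le)]
  exact (isBigO_zero _ _).congr' h1.symm EventuallyEq.rfl

/-- **Holomorphy on `Re w > 0`** of `w ↦ ∫_1^∞ h(v) v^{−w−1} dv` when `‖h(v)‖ ≤ C(1 + log v)`: the integrand is a
Mellin transform of a function `O(v^ε)` for every `ε > 0` and vanishing near `0`. [folklore] -/
theorem differentiableOn_mellin_Ioi_logGrowth (hm : AEStronglyMeasurable h (volume.restrict (Ioi 1)))
    (hb : ∀ v, 1 < v → ‖h v‖ ≤ C * (1 + Real.log v)) :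
    DifferentiableOn ℂ (fun w : ℂ ↦ ∫ v in Ioi (1 : ℝ), h v * (v : ℂ) ^ (-w - 1)) {w : ℂ | 0 < w.re} := by
  intro w hw
  simp only [mem_setOf_eq] at hw
  have hdiff : DifferentiableAt ℂ (mellin (indIoi h)) (-w) :=
    mellin_differentiableAt_of_isBigO_rpow (locallyIntegrableOn_indIoi hm hb)
      (indIoi_isBigO_top hb (half_pos hw)) (by simp only [neg_re]; linarith)
      (indIoi_isBigO_zero h (-w.re - 1)) (by simp only [neg_re]; linarith)
  have hfun : (fun w : ℂ ↦ ∫ v in Ioi (1 : ℝ), h v * (v : ℂ) ^ (-w - 1)) = fun w ↦ mellin (indIoi h) (-w) :=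
    funext (integral_mul_cpow_eq_mellin h)
  rw [hfun]
  exact (hdiff.comp w differentiableAt_id.neg).differentiableWithinAt

end MellinGeneric

/-! ### `s ∫₁^∞ Π_𝒫(x) x^{−s−1} dx = Σ_j log((1 − λ_j^{−s})⁻¹)` -/

/-- For `Re s > 0` and `Σ_j λ_j^{−σ} < ∞`: **`s ∫₁^∞ Π_𝒫(x) x^{−s−1} dx = Σ_j log((1 − λ_j^{−s})⁻¹)`** (the tree's
`mul_integral_riemannPrimeCount_eq_tsum` summed over `k` by the Mercator series `log_eulerFactor_hasSum`).
[cite: BrouckeDebruyneRevesz2023, proof of Theorem 3.2 ("log ζ_𝒫(s) = … = ℳ{dΠ_𝒫; s}")] -/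
theorem mul_integral_riemannPrimeCount_eq_tsum_log (P : BeurlingPrimes) {s : ℂ} (hs : 0 < s.re)
    (hsum : Summable fun j ↦ P.prime j ^ (-s.re)) :
    s * ∫ x in Ioi (1 : ℝ), ((P.riemannPrimeCount x : ℝ) : ℂ) * (x : ℂ) ^ (-s - 1) =
      ∑' j, Complex.log ((1 - ((P.prime j : ℝ) : ℂ) ^ (-s))⁻¹) := by
  rw [P.mul_integral_riemannPrimeCount_eq_tsum hs hsum]
  set f : ℕ × ℕ → ℂ := fun jk ↦
    (((1 / ((jk.2 : ℝ) + 1) : ℝ)) : ℂ) * (((P.prime jk.1 ^ (jk.2 + 1) : ℝ)) : ℂ) ^ (-s) with hf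
  have hnorm : ∀ jk, ‖f jk‖ = 1 / ((jk.2 : ℝ) + 1) * (P.prime jk.1 ^ (jk.2 + 1)) ^ (-s.re) := by
    intro jk
    rw [hf]
    simp only [norm_mul, Complex.norm_real, Real.norm_eq_abs]
    rw [abs_of_nonneg (by positivity), norm_cpow_eq_rpow_re_of_pos (pow_pos (P.prime_pos jk.1) _), neg_re]
  have hfs : Summable f := by
    refine Summable.of_norm ?_
    simp_rw [hnorm]
    exact summable_primePow_weight P hs hsum
  rw [hfs.tsum_prod' (fun j ↦ hfs.comp_injective (Prod.mk_right_injective j))]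
  exact tsum_congr fun j ↦ (P.log_eulerFactor_hasSum hs j).tsum_eq

namespace BDRMultiset

variable {R S : Multiset ℂ} {δ : ℝ} {M : ℕ} {P : BeurlingPrimes}

/-! ### `Z(s) = s ∫₁^∞ (Π_𝒫 − G)(x) x^{−s−1} dx` and its holomorphy on `Re s > 0` -/

variable (R S δ M P) in
/-- **BDR's `Z(s) = ℳ{dΠ_𝒫 − dG; s} = s ∫_1^∞ (Π_𝒫(x) − G(x)) x^{−s−1} dx`.**
[cite: BrouckeDebruyneRevesz2023, proof of Theorem 3.2 ("the error Z(s) := ℳ{dΠ_𝒫 − dG; s}")] -/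
def Zfn (s : ℂ) : ℂ :=
  s * ∫ x in Ioi (1 : ℝ), ((P.riemannPrimeCount x - tmplG R S δ M x : ℝ) : ℂ) * (x : ℂ) ^ (-s - 1)

/-- **`Z` is holomorphic on `Re s > 0`** as soon as `|Π_𝒫(x) − G(x)| ≤ C(1 + log x)` (`x ≥ 1`) and `0 ≤ δ ≤ 1`
(BDR: "the error function `Π_𝒫(x) − G(x)` … is `O(log log x)`. Hence `Z(s)` is analytic for `Re s > 0`").
[cite: BrouckeDebruyneRevesz2023, proof of Theorem 3.2] -/
theorem differentiableOn_Zfn (hδ : 0 ≤ δ) (hδ1 : δ ≤ 1) {C : ℝ}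
    (hPiG : ∀ x : ℝ, 1 ≤ x → |P.riemannPrimeCount x - tmplG R S δ M x| ≤ C * (1 + Real.log x)) :
    DifferentiableOn ℂ (Zfn R S δ M P) {s : ℂ | 0 < s.re} := by
  have hm : AEStronglyMeasurable (fun x : ℝ ↦ ((P.riemannPrimeCount x - tmplG R S δ M x : ℝ) : ℂ))
      (volume.restrict (Ioi 1)) :=
    (Complex.measurable_ofReal.comp (P.measurable_riemannPrimeCount.sub
      (continuous_tmplG hδ hδ1).measurable)).aestronglyMeasurable
  have hb : ∀ v, 1 < v → ‖((P.riemannPrimeCount v - tmplG R S δ M v : ℝ) : ℂ)‖ ≤ C * (1 + Real.log v) := fun v hv ↦ by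
    rw [Complex.norm_real, Real.norm_eq_abs]; exact hPiG v hv.le
  exact differentiableOn_id.mul (differentiableOn_mellin_Ioi_logGrowth hm hb)

/-! ### `s ∫₁^∞ G(x) x^{−s−1} dx = ∫₁^∞ g(u) u^{−s} du` -/

/-- `∫ₐᵇ densG = G b − G a` (`a ≤ b`). [folklore] -/
theorem integral_densG_eq (hS : ∀ ω ∈ S, ω.re ≤ 1) (hR : ∀ ρ ∈ R, ρ.re ≤ 1) (hδ : 0 ≤ δ) (hδ1 : δ ≤ 1) {a b : ℝ}
    (hab : a ≤ b) : ∫ u in a..b, densG R S δ M u = tmplG R S δ M b - tmplG R S δ M a :=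
  integral_density_eq (continuous_tmplG hδ hδ1) (fun _ hx ↦ tmplG_of_le_one hx) (fun _ hx ↦ hasDerivAt_tmplG hδ hδ1 hx)
    (fun _ hu ↦ densG_of_le_one hu) (measurable_densG hδ hδ1) (abs_densG_le hS hR hδ hδ1) hab

/-- `|G(x)| ≤ C_g (x − 1)` for `x ≥ 1`, `C_g` the global bound for `|densG|`. [folklore] -/
theorem abs_tmplG_le (hS : ∀ ω ∈ S, ω.re ≤ 1) (hR : ∀ ρ ∈ R, ρ.re ≤ 1) (hδ : 0 ≤ δ) (hδ1 : δ ≤ 1) {x : ℝ}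
    (hx : 1 ≤ x) :
    |tmplG R S δ M x| ≤ (sizeBound R S M * normBound R S * Real.exp (normBound R S) +
      (1 + 2 * Multiset.card S + 2 * Multiset.card R + M)) * (x - 1) := by
  have h := integral_densG_eq (M := M) hS hR hδ hδ1 hx
  rw [tmplG_of_le_one (le_refl (1:ℝ)), sub_zero] at h
  rw [← h]
  have hb := intervalIntegral.norm_integral_le_of_norm_le_const (a := 1) (b := x)
    (f := densG R S δ M) (C := sizeBound R S M * normBound R S * Real.exp (normBound R S) +
      (1 + 2 * Multiset.card S + 2 * Multiset.card R + M)) fun u _ ↦ by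
      rw [Real.norm_eq_abs]; exact abs_densG_le hS hR hδ hδ1 u
  rw [Real.norm_eq_abs, abs_of_nonneg (by linarith : (0:ℝ) ≤ x - 1)] at hb
  linarith [hb]

/-- **`s ∫₁^∞ G(x) x^{−s−1} dx = ∫₁^∞ g(u) u^{−s} du` for `Re s > 1`** (integration by parts: the tree's finite Abel
identity `BV.integral_tmplIntegrand_mul_cpow_eq` applied to the rescaled density `g/C`, then `X → ∞`).
[cite: BrouckeDebruyneRevesz2023, proof of Theorem 3.2 ("ℳ{dG; s}")] -/
theorem mul_integral_tmplG_eq (hS : ∀ ω ∈ S, ω.re ≤ 1) (hR : ∀ ρ ∈ R, ρ.re ≤ 1) (hδ : 0 ≤ δ) (hδ1 : δ ≤ 1)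
    {s : ℂ} (hs : 1 < s.re) :
    IntegrableOn (fun u : ℝ ↦ (densG R S δ M u : ℂ) * (u : ℂ) ^ (-s)) (Ioi 1) ∧
    IntegrableOn (fun x : ℝ ↦ ((tmplG R S δ M x : ℝ) : ℂ) * (x : ℂ) ^ (-s - 1)) (Ioi 1) ∧
      s * ∫ x in Ioi (1 : ℝ), ((tmplG R S δ M x : ℝ) : ℂ) * (x : ℂ) ^ (-s - 1) =
        ∫ u in Ioi (1 : ℝ), (densG R S δ M u : ℂ) * (u : ℂ) ^ (-s) := by
  set Cg : ℝ := sizeBound R S M * normBound R S * Real.exp (normBound R S) +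
    (1 + 2 * Multiset.card S + 2 * Multiset.card R + M) with hCg
  have hB := sizeBound_nonneg (R := R) (S := S) (M := M)
  have hQ := normBound_nonneg (R := R) (S := S)
  have hCg0 : 0 ≤ Cg := by positivity
  set C2 : ℝ := max Cg 1 with hC2
  have hC2pos : 0 < C2 := lt_of_lt_of_le one_pos (le_max_right _ _)
  -- the rescaled density
  set g' : ℝ → ℝ := fun u ↦ densG R S δ M u / C2 with hg'
  have hg'm : Measurable g' := (measurable_densG hδ hδ1).div_const _
  have hg'b : ∀ v, 1 < v → |g' v| ≤ 2 := fun v _ ↦ by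
    rw [hg', abs_div, abs_of_pos hC2pos, div_le_iff₀ hC2pos]
    have h1 := abs_densG_le (M := M) hS hR hδ hδ1 v
    rw [← hCg] at h1
    have h2 : Cg ≤ C2 := le_max_left _ _
    linarith
  -- integrability on `(1,∞)`
  have hσ : 1 < s.re := hs
  have hint_g : IntegrableOn (fun u : ℝ ↦ (densG R S δ M u : ℂ) * (u : ℂ) ^ (-s)) (Ioi 1) := by
    have hmeas : AEStronglyMeasurable (fun u : ℝ ↦ (densG R S δ M u : ℂ) * (u : ℂ) ^ (-s)) (volume.restrict (Ioi 1)) :=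
      ((Complex.measurable_ofReal.comp (measurable_densG hδ hδ1)).mul
        ((Complex.measurable_ofReal.comp measurable_id).pow_const _)).aestronglyMeasurable
    refine Integrable.mono' ((integrableOn_Ioi_rpow_of_lt (by linarith : -s.re < -1) one_pos).const_mul Cg) hmeas ?_
    rw [ae_restrict_iff' measurableSet_Ioi]
    refine Eventually.of_forall fun u hu ↦ ?_
    have hu0 : 0 < u := lt_trans one_pos hu
    rw [norm_mul, Complex.norm_real, Real.norm_eq_abs, norm_cpow_eq_rpow_re_of_pos hu0, neg_re]
    exact mul_le_mul_of_nonneg_right (abs_densG_le hS hR hδ hδ1 u) (Real.rpow_nonneg hu0.le _)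
  have hint_G : IntegrableOn (fun x : ℝ ↦ ((tmplG R S δ M x : ℝ) : ℂ) * (x : ℂ) ^ (-s - 1)) (Ioi 1) := by
    have hmeas : AEStronglyMeasurable (fun x : ℝ ↦ ((tmplG R S δ M x : ℝ) : ℂ) * (x : ℂ) ^ (-s - 1)) (volume.restrict (Ioi 1)) :=
      ((Complex.measurable_ofReal.comp (continuous_tmplG hδ hδ1).measurable).mul
        ((Complex.measurable_ofReal.comp measurable_id).pow_const _)).aestronglyMeasurable
    refine Integrable.mono' ((integrableOn_Ioi_rpow_of_lt (by linarith : -s.re < -1) one_pos).const_mul Cg) hmeas ?_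
    rw [ae_restrict_iff' measurableSet_Ioi]
    refine Eventually.of_forall fun x hx ↦ ?_
    have hx0 : 0 < x := lt_trans one_pos hx
    rw [norm_mul, Complex.norm_real, Real.norm_eq_abs, norm_cpow_eq_rpow_re_of_pos hx0, sub_re, neg_re, one_re]
    have h1 := abs_tmplG_le (M := M) hS hR hδ hδ1 hx.le
    rw [← hCg] at h1
    calc |tmplG R S δ M x| * x ^ (-s.re - 1) ≤ Cg * (x - 1) * x ^ (-s.re - 1) :=
          mul_le_mul_of_nonneg_right h1 (Real.rpow_nonneg hx0.le _)
      _ ≤ Cg * x * x ^ (-s.re - 1) := by gcongr; linarith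
      _ = Cg * x ^ (-s.re) := by
          rw [Real.rpow_sub_one hx0.ne']; field_simp
  refine ⟨hint_g, hint_G, ?_⟩
  -- the finite Abel identity for `g'`, rescaled
  have habel : ∀ X : ℝ, 1 ≤ X → ∫ u in (1 : ℝ)..X, (densG R S δ M u : ℂ) * (u : ℂ) ^ (-s) =
      ((tmplG R S δ M X : ℝ) : ℂ) * (X : ℂ) ^ (-s) + s * ∫ v in (1 : ℝ)..X, ((tmplG R S δ M v : ℝ) : ℂ) * (v : ℂ) ^ (-s - 1) := by
    intro X hX
    have h := BV.integral_tmplIntegrand_mul_cpow_eq hg'm hg'b hX 0 s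
    -- `tmplIntegrand g' 0 u = g' u`, `tmplSum g' v 0 = ∫₁ᵛ g' = G(v)/C2`
    have h1 : ∀ u : ℝ, BV.tmplIntegrand g' 0 u = (g' u : ℂ) := fun u ↦ by simp [BV.tmplIntegrand]
    have h2 : ∀ v : ℝ, 1 ≤ v → BV.tmplSum g' v 0 = ((tmplG R S δ M v / C2 : ℝ) : ℂ) := by
      intro v hv
      rw [BV.tmplSum_zero]
      congr 1
      rw [hg', intervalIntegral.integral_div, integral_densG_eq hS hR hδ hδ1 hv, tmplG_of_le_one (le_refl (1:ℝ)), sub_zero]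
    simp only [h1] at h
    rw [h2 X hX] at h
    have hinner : ∫ v in (1 : ℝ)..X, BV.tmplSum g' v 0 * (v : ℂ) ^ (-s - 1) =
        ∫ v in (1 : ℝ)..X, ((tmplG R S δ M v / C2 : ℝ) : ℂ) * (v : ℂ) ^ (-s - 1) :=
      intervalIntegral.integral_congr fun v hv ↦ by rw [uIcc_of_le hX] at hv; rw [h2 v hv.1]
    rw [hinner] at h
    -- multiply by `C2`
    have hC2 : (C2 : ℂ) ≠ 0 := ofReal_ne_zero.2 hC2pos.ne'
    have h3 : ∀ u : ℝ, (densG R S δ M u : ℂ) = C2 * (g' u : ℂ) := fun u ↦ by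
      rw [hg']; push_cast; field_simp
    calc ∫ u in (1 : ℝ)..X, (densG R S δ M u : ℂ) * (u : ℂ) ^ (-s)
        = C2 * ∫ u in (1 : ℝ)..X, (g' u : ℂ) * (u : ℂ) ^ (-s) := by
          rw [← intervalIntegral.integral_const_mul]
          exact intervalIntegral.integral_congr fun u _ ↦ by rw [h3 u]; ring
      _ = C2 * (((tmplG R S δ M X / C2 : ℝ) : ℂ) * (X : ℂ) ^ (-s) +
            s * ∫ v in (1 : ℝ)..X, ((tmplG R S δ M v / C2 : ℝ) : ℂ) * (v : ℂ) ^ (-s - 1)) := by rw [h]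
      _ = ((tmplG R S δ M X : ℝ) : ℂ) * (X : ℂ) ^ (-s) + s * ∫ v in (1 : ℝ)..X, ((tmplG R S δ M v : ℝ) : ℂ) * (v : ℂ) ^ (-s - 1) := by
          rw [mul_add]
          congr 1
          · push_cast; field_simp
          · rw [mul_left_comm, ← intervalIntegral.integral_const_mul]
            congr 1
            exact intervalIntegral.integral_congr fun v _ ↦ by push_cast; field_simp
  -- the limits `X → ∞`
  have hL : Tendsto (fun X : ℝ ↦ ∫ u in (1 : ℝ)..X, (densG R S δ M u : ℂ) * (u : ℂ) ^ (-s)) atTop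
      (𝓝 (∫ u in Ioi (1 : ℝ), (densG R S δ M u : ℂ) * (u : ℂ) ^ (-s))) :=
    intervalIntegral_tendsto_integral_Ioi 1 hint_g tendsto_id
  have hR1 : Tendsto (fun X : ℝ ↦ ((tmplG R S δ M X : ℝ) : ℂ) * (X : ℂ) ^ (-s)) atTop (𝓝 0) := by
    have hdecay : Tendsto (fun X : ℝ ↦ Cg * X ^ (1 - s.re)) atTop (𝓝 0) := by
      have := (tendsto_rpow_neg_atTop (by linarith : 0 < s.re - 1)).const_mul Cg
      rw [mul_zero] at this
      refine this.congr fun X ↦ ?_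
      rw [neg_sub]
    refine squeeze_zero_norm' ?_ hdecay
    filter_upwards [eventually_ge_atTop (1 : ℝ)] with X hX
    have hX0 : 0 < X := by linarith
    rw [norm_mul, Complex.norm_real, Real.norm_eq_abs, norm_cpow_eq_rpow_re_of_pos hX0, neg_re]
    have h1 := abs_tmplG_le (M := M) hS hR hδ hδ1 hX
    rw [← hCg] at h1
    calc |tmplG R S δ M X| * X ^ (-s.re) ≤ Cg * (X - 1) * X ^ (-s.re) := mul_le_mul_of_nonneg_right h1 (Real.rpow_nonneg hX0.le _)
      _ ≤ Cg * X * X ^ (-s.re) := by gcongr; linarith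
      _ = Cg * X ^ (1 - s.re) := by rw [sub_eq_add_neg, Real.rpow_add hX0, Real.rpow_one]; ring
  have hR2 : Tendsto (fun X : ℝ ↦ s * ∫ v in (1 : ℝ)..X, ((tmplG R S δ M v : ℝ) : ℂ) * (v : ℂ) ^ (-s - 1)) atTop
      (𝓝 (s * ∫ v in Ioi (1 : ℝ), ((tmplG R S δ M v : ℝ) : ℂ) * (v : ℂ) ^ (-s - 1))) :=
    (intervalIntegral_tendsto_integral_Ioi 1 hint_G tendsto_id).const_mul s
  have hRt := hR1.add hR2
  rw [zero_add] at hRt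
  refine (tendsto_nhds_unique hL (hRt.congr' ?_)).symm
  filter_upwards [eventually_ge_atTop (1 : ℝ)] with X hX
  exact (habel X hX).symm

/-! ### `exp ∫₁^∞ g(u) u^{−s} du = E_M(s)` -/

/-- `cpowDensity z u = (u^z − 1)/(u log u)` for `u > 0`. [folklore] -/
theorem cpowDensity_eq_div {u : ℝ} (hu : 0 < u) (z : ℂ) :
    cpowDensity z u = ((u : ℂ) ^ z - 1) / ((u : ℂ) * (Real.log u : ℂ)) := by
  have hu0 : (u : ℂ) ≠ 0 := ofReal_ne_zero.2 hu.ne'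
  rw [cpowDensity, Complex.cpow_sub _ _ hu0, Complex.cpow_one]
  rcases eq_or_ne (Real.log u) 0 with hl | hl
  · simp [hl]
  · have hl' : (Real.log u : ℂ) ≠ 0 := ofReal_ne_zero.2 hl
    field_simp

/-- `Re cpowDensity z u = Re(u^z − 1)/(u log u)` for `u > 0`. [folklore] -/
theorem re_cpowDensity {u : ℝ} (hu : 0 < u) (z : ℂ) :
    (cpowDensity z u).re = ((u : ℂ) ^ z - 1).re / (u * Real.log u) := by
  rw [cpowDensity_eq_div hu, ← Complex.ofReal_mul, Complex.div_ofReal_re]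

/-- **The density `g` in complex form** (symmetric multisets): for `u > 1`,
`g(u) = cpowDensity 1 u + Σ_𝒮 cpowDensity ω u − Σ_ℛ cpowDensity ρ u + M cpowDensity δ u`.
[cite: BrouckeDebruyneRevesz2023, proof of Theorem 3.2 ((3.3) and "ℳ{dG; s}")] -/
theorem ofReal_densG_eq (hSsymm : S.map conj = S) (hRsymm : R.map conj = R) {u : ℝ} (hu : 1 < u) :
    (densG R S δ M u : ℂ) = cpowDensity 1 u + (S.map fun ω ↦ cpowDensity ω u).sum -
      (R.map fun ρ ↦ cpowDensity ρ u).sum + M * cpowDensity δ u := by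
  have hu0 : 0 < u := by linarith
  have hlog : 0 < Real.log u := Real.log_pos hu
  -- the complex sums are real
  have hS := sum_map_eq_ofReal_of_symm hSsymm (φ := fun ω ↦ cpowDensity ω u) fun z ↦ cpowDensity_conj hu0 z
  have hR := sum_map_eq_ofReal_of_symm hRsymm (φ := fun ρ ↦ cpowDensity ρ u) fun z ↦ cpowDensity_conj hu0 z
  have h1 : cpowDensity 1 u = (((cpowDensity 1 u).re : ℝ) : ℂ) := by
    refine (Complex.conj_eq_iff_re.1 ?_).symm
    rw [← cpowDensity_conj hu0 1, map_one]
  have hδc : cpowDensity δ u = (((cpowDensity δ u).re : ℝ) : ℂ) := by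
    refine (Complex.conj_eq_iff_re.1 ?_).symm
    rw [← cpowDensity_conj hu0 δ, Complex.conj_ofReal]
  rw [hS, hR, h1, hδc]
  -- now everything is real: compare with `NG_log_eq`
  have hreal : densG R S δ M u = (cpowDensity 1 u).re + (S.map fun ω ↦ (cpowDensity ω u).re).sum -
      (R.map fun ρ ↦ (cpowDensity ρ u).re).sum + M * (cpowDensity δ u).re := by
    rw [densG_of_one_lt hu, NG_log_eq R S δ M hu0]
    simp only [re_cpowDensity hu0]
    have e1 : ((u : ℂ) ^ (1 : ℂ) - 1).re = u - 1 := by rw [Complex.cpow_one]; simp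
    have eδ : (((u : ℂ)) ^ ((δ : ℂ)) - 1).re = u ^ δ - 1 := by
      rw [← Complex.ofReal_cpow hu0.le, ← Complex.ofReal_one, ← Complex.ofReal_sub, Complex.ofReal_re]
    rw [e1, eδ]
    have hden : u * Real.log u ≠ 0 := mul_ne_zero hu0.ne' hlog.ne'
    have eS : (S.map fun ω ↦ ((u : ℂ) ^ ω - 1).re / (u * Real.log u)).sum = (S.map fun ω ↦ ((u : ℂ) ^ ω - 1).re).sum / (u * Real.log u) := by
      simp only [div_eq_mul_inv, Multiset.sum_map_mul_right]
    have eR : (R.map fun ρ ↦ ((u : ℂ) ^ ρ - 1).re / (u * Real.log u)).sum = (R.map fun ρ ↦ ((u : ℂ) ^ ρ - 1).re).sum / (u * Real.log u) := by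
      simp only [div_eq_mul_inv, Multiset.sum_map_mul_right]
    rw [eS, eR]
    field_simp
  rw [hreal]
  push_cast
  ring

/-- Integrals of multiset sums of integrable functions. [folklore] -/
theorem integral_multiset_sum_map {X : Multiset ℂ} {φ : ℂ → ℝ → ℂ} {μ : Measure ℝ}
    (hφ : ∀ z ∈ X, Integrable (φ z) μ) :
    ∫ u, (X.map fun z ↦ φ z u).sum ∂μ = (X.map fun z ↦ ∫ u, φ z u ∂μ).sum ∧
      Integrable (fun u ↦ (X.map fun z ↦ φ z u).sum) μ := by
  induction X using Multiset.induction_on with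
  | empty => simp
  | cons a X ih =>
    have ha : Integrable (φ a) μ := hφ a (Multiset.mem_cons_self a X)
    obtain ⟨ih1, ih2⟩ := ih fun z hz ↦ hφ z (Multiset.mem_cons_of_mem hz)
    simp only [Multiset.map_cons, Multiset.sum_cons]
    refine ⟨?_, ha.add ih2⟩
    rw [integral_add ha ih2, ih1]

/-- **`exp ∫₁^∞ g(u) u^{−s} du = E_M(s)`** for `Re s > 1` (symmetric `𝒮, ℛ` with `Re ω, Re ρ < Re s`, `δ < Re s`):
`exp(ℳ{dG; s}) = s/(s−1) ∏_𝒮 s/(s−ω) ∏_ℛ (s−ρ)/s (s/(s−δ))^M`. [cite: BrouckeDebruyneRevesz2023, Theorem 3.2 (display for E_M) and its proof] -/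
theorem exp_integral_densG (hSsymm : S.map conj = S) (hRsymm : R.map conj = R) (hS : ∀ ω ∈ S, ω.re ≤ 1)
    (hR : ∀ ρ ∈ R, ρ.re ≤ 1) (hδ1 : δ ≤ 1) {s : ℂ} (hs : 1 < s.re) :
    Complex.exp (∫ u in Ioi (1 : ℝ), (densG R S δ M u : ℂ) * (u : ℂ) ^ (-s)) = bdrE R S δ M s := by
  have hs0 : 0 < s.re := by linarith
  have hz : ∀ z : ℂ, z.re ≤ 1 → z.re < s.re := fun z hz ↦ lt_of_le_of_lt hz hs
  -- rewrite the integrand on `(1,∞)`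
  have heq : ∀ u ∈ Ioi (1 : ℝ), (densG R S δ M u : ℂ) * (u : ℂ) ^ (-s) =
      cpowDensity 1 u * (u : ℂ) ^ (-s) + (S.map fun ω ↦ cpowDensity ω u * (u : ℂ) ^ (-s)).sum -
        (R.map fun ρ ↦ cpowDensity ρ u * (u : ℂ) ^ (-s)).sum + M * (cpowDensity δ u * (u : ℂ) ^ (-s)) := by
    intro u hu
    rw [ofReal_densG_eq hSsymm hRsymm hu]
    simp only [add_mul, sub_mul, Multiset.sum_map_mul_right, mul_assoc]
  rw [setIntegral_congr_fun measurableSet_Ioi heq]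
  -- integrability of the pieces
  have hi : ∀ z : ℂ, z.re ≤ 1 → Integrable (fun u : ℝ ↦ cpowDensity z u * (u : ℂ) ^ (-s)) (volume.restrict (Ioi 1)) :=
    fun z hz1 ↦ (integral_cpowDensity_mul_cpow hs0 (hz z hz1)).1
  have hi1 := hi 1 (by simp)
  have hiδ := hi δ (by simpa using hδ1)
  obtain ⟨hSint, hSi⟩ := integral_multiset_sum_map (X := S) (μ := volume.restrict (Ioi 1))
    (φ := fun ω u ↦ cpowDensity ω u * (u : ℂ) ^ (-s)) fun ω hω ↦ hi ω (hS ω hω)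
  obtain ⟨hRint, hRi⟩ := integral_multiset_sum_map (X := R) (μ := volume.restrict (Ioi 1))
    (φ := fun ρ u ↦ cpowDensity ρ u * (u : ℂ) ^ (-s)) fun ρ hρ ↦ hi ρ (hR ρ hρ)
  have hA2 : Integrable (fun u : ℝ ↦ cpowDensity 1 u * (u : ℂ) ^ (-s) +
      (S.map fun ω ↦ cpowDensity ω u * (u : ℂ) ^ (-s)).sum) (volume.restrict (Ioi 1)) := hi1.add hSi
  have hA3 : Integrable (fun u : ℝ ↦ cpowDensity 1 u * (u : ℂ) ^ (-s) +
      (S.map fun ω ↦ cpowDensity ω u * (u : ℂ) ^ (-s)).sum - (R.map fun ρ ↦ cpowDensity ρ u * (u : ℂ) ^ (-s)).sum)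
      (volume.restrict (Ioi 1)) := hA2.sub hRi
  have hD : Integrable (fun u : ℝ ↦ (M : ℂ) * (cpowDensity δ u * (u : ℂ) ^ (-s))) (volume.restrict (Ioi 1)) :=
    hiδ.const_mul _
  rw [integral_add hA3 hD, integral_sub hA2 hRi, integral_add hi1 hSi, hSint, hRint, MeasureTheory.integral_const_mul]
  -- exponentiate
  rw [Complex.exp_add, Complex.exp_sub, Complex.exp_add, Complex.exp_multiset_sum, Complex.exp_multiset_sum,
    Multiset.map_map, Multiset.map_map, Complex.exp_nat_mul]
  rw [exp_integral_cpowDensity_mul_cpow hs0 (hz 1 (by simp)),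
    exp_integral_cpowDensity_mul_cpow hs0 (by simpa using lt_of_le_of_lt hδ1 hs)]
  have eS : (S.map (Complex.exp ∘ fun ω ↦ ∫ u in Ioi (1 : ℝ), cpowDensity ω u * (u : ℂ) ^ (-s))).prod =
      (S.map fun ω ↦ s / (s - ω)).prod :=
    congrArg Multiset.prod (Multiset.map_congr rfl fun ω hω ↦ exp_integral_cpowDensity_mul_cpow hs0 (hz ω (hS ω hω)))
  have eR : (R.map (Complex.exp ∘ fun ρ ↦ ∫ u in Ioi (1 : ℝ), cpowDensity ρ u * (u : ℂ) ^ (-s))).prod =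
      (R.map fun ρ ↦ s / (s - ρ)).prod :=
    congrArg Multiset.prod (Multiset.map_congr rfl fun ρ hρ ↦ exp_integral_cpowDensity_mul_cpow hs0 (hz ρ (hR ρ hρ)))
  rw [eS, eR, bdrE]
  -- `(∏_R s/(s−ρ))⁻¹ = ∏_R (s−ρ)/s`
  have hs_ne : s ≠ 0 := fun h ↦ by rw [h] at hs0; simp at hs0
  have hinv : ((R.map fun ρ ↦ s / (s - ρ)).prod)⁻¹ = (R.map fun ρ ↦ (s - ρ) / s).prod := by
    rw [← Multiset.prod_map_inv]
    exact congrArg Multiset.prod (Multiset.map_congr rfl fun ρ _ ↦ by rw [inv_div])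
  rw [div_eq_mul_inv, hinv]

/-! ### `ζ_𝒫(s) = E_M(s) e^{Z(s)}` -/

/-- **`ζ_𝒫(s) = E_M(s) e^{Z(s)}` for `Re s > 1`** (BDR: "we have `E(s) = exp(ℳ{dG; s})`, so that
`ζ_𝒫(s) = E(s)e^{Z(s)}`"), for any Beurling system with `Σ_j λ_j^{−σ} < ∞` for `σ > 1` and the template data of
Theorem 3.2 (`𝒮, ℛ` symmetric, `Re ω, Re ρ ≤ 1`, `0 ≤ δ ≤ 1`). [cite: BrouckeDebruyneRevesz2023, proof of Theorem 3.2] -/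
theorem zeta_eq_bdrE_mul_exp_Zfn (hSsymm : S.map conj = S) (hRsymm : R.map conj = R) (hS : ∀ ω ∈ S, ω.re ≤ 1)
    (hR : ∀ ρ ∈ R, ρ.re ≤ 1) (hδ : 0 ≤ δ) (hδ1 : δ ≤ 1)
    (hsum : ∀ σ : ℝ, 1 < σ → Summable fun j ↦ P.prime j ^ (-σ))
    (hintPi : ∀ s : ℂ, 1 < s.re → IntegrableOn (fun x : ℝ ↦ ((P.riemannPrimeCount x : ℝ) : ℂ) * (x : ℂ) ^ (-s - 1)) (Ioi 1))
    {s : ℂ} (hs : 1 < s.re) :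
    P.zeta s = bdrE R S δ M s * Complex.exp (Zfn R S δ M P s) := by
  have hs0 : 0 < s.re := by linarith
  rw [P.zeta_eq_exp_mul_integral_riemannPrimeCount hs0 (hsum s.re hs)]
  obtain ⟨hint_g, hint_G, hparts⟩ := mul_integral_tmplG_eq (M := M) hS hR hδ hδ1 hs
  -- split `Π = (Π − G) + G` inside the integral
  have hsplit : ∫ x in Ioi (1 : ℝ), ((P.riemannPrimeCount x : ℝ) : ℂ) * (x : ℂ) ^ (-s - 1) =
      (∫ x in Ioi (1 : ℝ), ((P.riemannPrimeCount x - tmplG R S δ M x : ℝ) : ℂ) * (x : ℂ) ^ (-s - 1)) +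
        ∫ x in Ioi (1 : ℝ), ((tmplG R S δ M x : ℝ) : ℂ) * (x : ℂ) ^ (-s - 1) := by
    rw [← integral_add ?_ hint_G]
    · refine setIntegral_congr_fun measurableSet_Ioi fun x _ ↦ ?_
      push_cast; ring
    · have h := (hintPi s hs).sub hint_G
      refine h.congr ?_
      exact Eventually.of_forall fun x ↦ by simp only [Pi.sub_apply]; push_cast; ring
  rw [hsplit, mul_add, Complex.exp_add, hparts, exp_integral_densG hSsymm hRsymm hS hR hδ1 hs, Zfn, mul_comm]

end BDRMultiset

end Literature.NumberTheory.BeurlingPrimes
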